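import Literature.AnabelianGeometry.EtaleTheta.TemperedFrobenioidOfGaloisCoveringOneComponent
import Literature.AnabelianGeometry.EtaleTheta.TemperedFrobenioidOfGaloisCoveringRankOnePoint
import HarnessLib

/-!
# [EtTh] Def 3.6 (ii) at the one-component model, WEAK data of record: the rank-one point `G/1 = X` and the tempered
# Frobenioid over `ofRlfZWeak (ofGaloisActionConnected (trivial (oneComp U hU) 1) _) hpf`

S. Mochizuki, *The étale theta function …*, Publ. RIMS **45** (2009) [MochizukiEtTh2009], Def. 3.3 (iii) PDF p. 73,
Def. 3.6 (i)(ii) pp. 76–77 [cite: MochizukiEtTh2009, Def 3.6 p.77]; [FrdII] Ex. 1.1.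

abc-iut cell, block C / W6, seat abc-iut-w6-d048 (gen 3); L2-lead R311 (one-component TWIN of the Tate-tower model of record).
CLASS (b) instance file (one `def` = a `RankOnePoint`; the rest by name): `OneCompFrd.rankOnePoint` — `S₀ := G/1` (the curve
`X` with smooth reduction, `G = Gal(Z_∞/X) = 1`), `e := OneCompFrd.phiZeroEquivNat` (`Φ₀(X) = ℤ_{≥0}·[F] ≅ ℕ`), `hcnst`:
`n·[F] = div₀(ϖⁿ)`; hence `OneCompFrd.temperedFrobenioidWeak := TemperedFrobenioid.ofRankOnePoint …` over the WEAK constructed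
data (the vocabulary of record), its re-base to `ConnectedPart (BTemp Π)`, and the non-vacuity theorems.  Companion of
`TemperedFrobenioidOfGaloisCoveringOneComponent.lean` (same seat: the PRINTED-vocabulary witness `temperedFrobenioidOneComp`).
HONEST LABEL as there: smooth reduction, one component, all log-meromorphic functions constant; one point of `D₀`.
Nothing here bears on [IUTchIII] Cor. 3.12; no side taken; typed ≠ proved for anything else.
-/

noncomputable section

namespace Literature.AnabelianGeometry.EtaleTheta

open CategoryTheory Opposite Literature.AlgebraicGeometry.Frobenioids Literature.AnabelianGeometry.SemiGraphs
  LogDivisorModel LogDivisorModel.GaloisAction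

namespace OneCompFrd

variable (U : Type) [CommGroup U] (hU : ∀ u : U, (∀ N : ℕ+, ∃ g : U, g ^ (N : ℕ) = u) → u = 1)

/-- **The rank-one point of the one-component model**: `S₀ = G/1` (= `X`), `Φ₀(X) ≅ ℕ`, `n·[F] = div₀(ϖⁿ)` with `ϖⁿ`
constant. [cite: MochizukiEtTh2009, Def 3.3 p.73] -/
def rankOnePoint : TemperedFrobenioid.RankOnePoint (act U hU) where
  S₀ := pt
  e := phiZeroEquivNat U hU pt
  hcnst m := ⟨cnstFn U hU 1 (multAt U hU pt m), fun _ => trivial, by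
    rw [show (act U hU).divZeroHom pt.obj (cnstFn U hU 1 (multAt U hU pt m)) =
        (dm U hU).div₀ (op pt) (cnstFn U hU 1 (multAt U hU pt m)) from rfl, div₀_cnstFn]
    exact congrArg Algebra.GrothendieckGroup.of ((phiZeroEquivNat U hU pt).symm_apply_apply m)⟩

variable (R S : ((Discrete PUnit.{1})ᵒᵖ ⥤ CommMonCat.{0}) → Prop)

/-- **The tempered Frobenioid of the one-component model over the WEAK constructed data** (vocabulary of record).
[cite: MochizukiEtTh2009, Def 3.6 p.77] -/
def temperedFrobenioidWeak :
    TemperedFrobenioid (RealifiedDivisorMonoids.ofRlfZWeak (dm U hU) (hpfCof_oneComp U hU)) (Discrete PUnit.{1})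
      (treeCatVocab (Discrete PUnit.{1}) R S) :=
  TemperedFrobenioid.ofRankOnePoint (cuspLaws_oneComp U hU) (rankOnePoint U hU) (hpfCof_oneComp U hU) R S

/-- Non-vacuity, weak data, one-point base. [cite: MochizukiEtTh2009, Def 3.6 p.77] -/
theorem nonempty_temperedFrobenioidWeak :
    Nonempty (TemperedFrobenioid (RealifiedDivisorMonoids.ofRlfZWeak
      (DivisorMonoids.ofGaloisActionConnected (act U hU) (cuspLaws_oneComp U hU)) (hpfCof_oneComp U hU))
      (Discrete PUnit.{1}) (treeCatVocab (Discrete PUnit.{1}) R S)) :=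
  ⟨temperedFrobenioidWeak U hU R S⟩

/-- Non-vacuity, weak data, genuine base `B^temp(Π)⁰` (every topological group `Π`). [cite: MochizukiEtTh2009, Def 3.6 p.77] -/
theorem nonempty_temperedFrobenioidWeak_connectedPart (Γ : Type) [Group Γ] [TopologicalSpace Γ]
    (R' S' : ((ConnectedPart (BTemp Γ))ᵒᵖ ⥤ CommMonCat.{0}) → Prop) :
    Nonempty (TemperedFrobenioid (RealifiedDivisorMonoids.ofRlfZWeak
      (DivisorMonoids.ofGaloisActionConnected (act U hU) (cuspLaws_oneComp U hU)) (hpfCof_oneComp U hU))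
      (ConnectedPart (BTemp Γ)) (treeCatVocab (ConnectedPart (BTemp Γ)) R' S')) :=
  TemperedFrobenioid.nonempty_of_rankOnePoint_connectedPart (cuspLaws_oneComp U hU) (hpfCof_oneComp U hU) Γ
    (rankOnePoint U hU) R' S'

/-- The weak witness IS a Frobenioid ([FrdI] Thm. 5.2 (ii)). [cite: MochizukiFrdI2008, Thm. 5.2 (ii) p.100] -/
theorem isFrobenioid_temperedFrobenioidWeak : PreFrobenioid.IsFrobenioid (temperedFrobenioidWeak U hU R S).toElem :=
  TemperedFrobenioid.isFrobenioid_ofRankOnePoint (cuspLaws_oneComp U hU) (rankOnePoint U hU) (hpfCof_oneComp U hU) R S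

end OneCompFrd

end Literature.AnabelianGeometry.EtaleTheta

end
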